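import Literature.NumberTheory.IwasawaTheory.Greenberg2006.CoinducedModuleDual
import Mathlib.Algebra.Polynomial.Roots
import HarnessLib

/-!
# Crux `AnticyclotomicEisensteinDivisibility` (stmt-BirchSwinnertonDyer-20727), line `bdpline` v15, stub
# `stub_finiteExponentSS`, Greenberg-2016 road at corank `n`: the ALGEBRA of the determinant form of
# Greenberg 2010 Lemma 5.2.2 — a non-zero polynomial with constant coefficients does not vanish at a
# non-trivial group-like element `(1+T₁)^{c₁}(1+T₂)^{c₂}` of `Λ₂ = 𝒪⟦T₂⟧⟦T₁⟧`, and an "eigenvector" of a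
# polynomially constrained `Λ`-linear map with such an eigenvalue is zero (helper for stmt-BirchSwinnertonDyer-20727)

Cell `bsd-ssimc` (hosting route `SignedBaseChange`), width seat `bsd-line-sbc-p1-w2` gen 3; fifth file of
the lane `stub_finiteExponentSS` via Greenberg 2016 Prop. 4.1.1 for `𝐃 = Ind_{K̃_∞/K}(E_K[p^∞])`
(`…FiniteExponentOfBridge` p624977, `…GreenbergFullAtSqueeze` p625450, `…BridgeForCurve` p625961,
`…CurveModel`). What remains there is the corank-TWO instance data of Prop. 4.1.1, in particular
LOC_v⁽¹⁾(`𝐃`) (`(T*)^{G_{K_v}} = 0`) and `corank H⁰(K_v, 𝐃) = 0` at the places `v ∈ Σ`. Cell `bsd-eis`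
proved these for a corank-ONE `A` on which `σ ∈ Γ_{K_v}` acts by a unit SCALAR `t`
(`TwistDeformationCofree.twistDeformation_LOC1`: equivariance reads `F · tγ^{-κ(σ)} = u · F` in the domain
`Λ₂`, and `tγ^{-κ(σ)} ≠ u`). For `E_K[p^∞]` the element `σ` acts through a `2 × 2` matrix; Greenberg's own
argument ([Greenberg2010] Lemma 5.2.2: "Suppose that `v ∈ Σ` and that the decomposition subgroup of `Γ` for
`v` is nontrivial. Then `H⁰(K_v, T*) = 0`"; [Greenberg2006] p. 342 L35–36 "one sees easily that
`(T*)^{G_{K_v}} = 0`") is the DETERMINANT form: a fixed vector `y` of `B ⊗ u` (`B` a matrix over the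
constants, `u = γ^{κ(σ)}` group-like and non-constant) satisfies `χ(u) · y = 0` for a non-zero constant-
coefficient polynomial `χ` (Cayley–Hamilton), and `χ(u) ≠ 0`. This file is the pure algebra of that step,
generic over a domain `𝒪` with `ℤ_p ↪ 𝒪`:

* §1 `constantCoeff_constantCoeff_transSeries` — the augmentation `ε : 𝒪⟦T₂⟧⟦T₁⟧ → 𝒪` (both constant
  coefficients, an `𝒪`-algebra map) sends `(1+T₁)^{c₁}(1+T₂)^{c₂} ↦ 1`.
* §2 `aeval_transSeries_ne_zero` — **for `(c₁, c₂) ≠ (0, 0)` and a non-zero `P ∈ 𝒪[X]`,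
  `P((1+T₁)^{c₁}(1+T₂)^{c₂}) ≠ 0` in `Λ₂`**: write `P = (X − 1)^k Q` with `Q(1) ≠ 0`
  (`Polynomial.exists_eq_pow_rootMultiplicity_mul_and_not_dvd`); `u − 1 ≠ 0`
  (`IndModule₂.transSeries_ne_one`) and `ε(Q(u)) = Q(1) ≠ 0`.
* §3 `eq_zero_of_apply_eq_smul_of_aeval_eq_zero` — over a domain `Λ`, for a `Λ`-linear `S` on a
  torsion-free `Λ`-module with `P(S) = 0` and `P(u) ≠ 0`: `S y = u • y ⟹ y = 0` (since `P(S) y = P(u) • y`).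

Theorems only; no definition, no named fact, no `sorry`. HONEST FRAMING: generic
algebra; closes nothing by itself (`--supports stmt-BirchSwinnertonDyer-20727`); the Galois wrapper
(LOC_v⁽¹⁾ / `corank H⁰ = 0` for the twist deformation of a cofree `A` of any corank, from a `σ` with
`κ(σ) ≠ 1` acting on `μ_{p^∞}` by a scalar, via Cayley–Hamilton on the Pontryagin dual of `A`) is the next
brick; no summit statement / BSD is proved by this file.
References: [Greenberg2010] R. Greenberg, *Surjectivity of the global-to-local map defining a Selmer
group*, Kyoto J. Math. 50 (2010), §5 (PDF p. 26 L1–5), Lemma 5.2.2 (PDF p. 28 L20–21); [Greenberg2006]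
Doc. Math. Extra Vol. Coates (2006), p. 342 L35–41; [CoatesSujatha2006Cyclotomic] §3.3 Lemma 3.3.4
(`𝓜(1_{ℤ_p}) = 1 + T`).
-/

-- `Summit.BirchSwinnertonDyer.BirchSwinnertonDyer.…`: summit and sub-problem share a name (D-0017 layout).
set_option linter.dupNamespace false
set_option autoImplicit false

noncomputable section

open scoped Classical
open Polynomial
open Literature.NumberTheory.IwasawaTheory.Greenberg2006
  Literature.NumberTheory.EllipticCurves

universe u

namespace Summit.BirchSwinnertonDyer.BirchSwinnertonDyer.Theorems.SignedBaseChangeAcDivGroupLikeAeval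

/-! ## §1 The augmentation `𝒪⟦T₂⟧⟦T₁⟧ → 𝒪` on group-like elements -/

section Augment

variable (𝒪 : Type u) [CommRing 𝒪]

/-- **Group-like elements augment to `1`**: both constant coefficients of `(1+T₁)^{c₁}(1+T₂)^{c₂}` are `1`
(`BigRepModule.constantCoeff_binomSeries`) — on the group-ring side, `Γ → 1` under `𝒪[[Γ]] → 𝒪`.
[cite: Greenberg2010, §5 (PDF p. 26 L1–5)] [cite: CoatesSujatha2006Cyclotomic, Lemma 3.3.4 (§3.3 p. 37)] -/
theorem constantCoeff_constantCoeff_transSeries {p : ℕ} [Fact p.Prime] [Algebra ℤ_[p] 𝒪] (c₁ c₂ : ℤ_[p]) :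
    PowerSeries.constantCoeff (PowerSeries.constantCoeff (IndModule₂.transSeries 𝒪 c₁ c₂)) = 1 := by
  rw [IndModule₂.transSeries, map_mul, BigRepModule.constantCoeff_binomSeries, one_mul,
    PowerSeries.constantCoeff_C, BigRepModule.constantCoeff_binomSeries]

/-- The double constant coefficient `Λ₂ = 𝒪⟦T₂⟧⟦T₁⟧ → 𝒪` commutes with the `𝒪`-algebra structure
(`ε ∘ algebraMap = id`), so it is an `𝒪`-algebra map. [cite: Greenberg2010, §5 (PDF p. 26 L1–5)] -/
theorem constantCoeff_constantCoeff_algebraMap (c : 𝒪) :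
    PowerSeries.constantCoeff (PowerSeries.constantCoeff
      (algebraMap 𝒪 (PowerSeries (PowerSeries 𝒪)) c)) = c := by
  rw [PowerSeries.algebraMap_apply, PowerSeries.constantCoeff_C, PowerSeries.algebraMap_apply,
    Algebra.algebraMap_self, RingHom.id_apply, PowerSeries.constantCoeff_C]

end Augment

/-! ## §2 Non-vanishing of constant-coefficient polynomials at a non-trivial group-like element -/

section Aeval

variable {𝒪 : Type u} [CommRing 𝒪] [IsDomain 𝒪] {p : ℕ} [Fact p.Prime] [Algebra ℤ_[p] 𝒪]

/-- **A non-zero `P ∈ 𝒪[X]` does not vanish at `u = (1+T₁)^{c₁}(1+T₂)^{c₂}` for `(c₁, c₂) ≠ (0, 0)`**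
(`𝒪` a domain, `ℤ_p ↪ 𝒪`): `P = (X − 1)^k · Q` with `Q(1) ≠ 0`; in the domain `Λ₂`, `(u − 1)^k ≠ 0`
because `u ≠ 1` (`IndModule₂.transSeries_ne_one`) and `Q(u) ≠ 0` because its augmentation is
`Q(1) ≠ 0`. (In particular a non-constant group-like `u` is not integral over the constants: it is no
eigenvalue of a matrix over `𝒪` — the determinant form of [Greenberg2010] Lemma 5.2.2.)
[cite: Greenberg2010, Lemma 5.2.2 (PDF p. 28 L20–21), §5 (PDF p. 26 L1–5)] [cite: Greenberg2006, p. 342 L35–36] -/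
theorem aeval_transSeries_ne_zero (hinj : Function.Injective (algebraMap ℤ_[p] 𝒪)) {c₁ c₂ : ℤ_[p]}
    (hc : c₁ ≠ 0 ∨ c₂ ≠ 0) {P : 𝒪[X]} (hP : P ≠ 0) :
    aeval (IndModule₂.transSeries 𝒪 c₁ c₂) P ≠ 0 := by
  set u : PowerSeries (PowerSeries 𝒪) := IndModule₂.transSeries 𝒪 c₁ c₂ with hu
  -- `P = (X - 1)^k * Q` with `Q(1) ≠ 0`
  obtain ⟨Q, hPQ, hQ⟩ := P.exists_eq_pow_rootMultiplicity_mul_and_not_dvd hP 1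
  have hQ1 : Q.eval 1 ≠ 0 := fun h ↦ hQ (dvd_iff_isRoot.mpr h)
  -- evaluate
  have hev : aeval u P = (u - 1) ^ P.rootMultiplicity 1 * aeval u Q := by
    conv_lhs => rw [hPQ]
    rw [map_mul, map_pow, map_sub, aeval_X, aeval_C, map_one]
  rw [hev]
  refine mul_ne_zero (pow_ne_zero _ (sub_ne_zero.mpr (IndModule₂.transSeries_ne_one hinj hc))) ?_
  intro h0
  -- the augmentation `ε : Λ₂ →ₐ[𝒪] 𝒪` (both constant coefficients) sends `u ↦ 1`, `Q(u) ↦ Q(1)`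
  let ε : PowerSeries (PowerSeries 𝒪) →ₐ[𝒪] 𝒪 :=
    AlgHom.mk' ((PowerSeries.constantCoeff (R := 𝒪)).comp (PowerSeries.constantCoeff (R := PowerSeries 𝒪)))
      fun c x ↦ by
        rw [RingHom.comp_apply, RingHom.comp_apply, Algebra.smul_def, map_mul, map_mul,
          constantCoeff_constantCoeff_algebraMap, smul_eq_mul]
  have hεu : ε u = 1 := constantCoeff_constantCoeff_transSeries 𝒪 c₁ c₂
  have h1 : ε (aeval u Q) = Q.eval 1 := by
    rw [← aeval_algHom_apply, hεu, coe_aeval_eq_eval]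
  rw [h0, map_zero] at h1
  exact hQ1 h1.symm

/-- The same for a polynomial with coefficients ALREADY in `Λ₂` but coming from `𝒪` (`P.map (algebraMap 𝒪 Λ₂)`),
in `eval` form. [cite: Greenberg2010, Lemma 5.2.2 (PDF p. 28 L20–21)] -/
theorem eval_map_transSeries_ne_zero (hinj : Function.Injective (algebraMap ℤ_[p] 𝒪)) {c₁ c₂ : ℤ_[p]}
    (hc : c₁ ≠ 0 ∨ c₂ ≠ 0) {P : 𝒪[X]} (hP : P ≠ 0) :
    (P.map (algebraMap 𝒪 (PowerSeries (PowerSeries 𝒪)))).eval (IndModule₂.transSeries 𝒪 c₁ c₂) ≠ 0 := by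
  rw [eval_map_algebraMap]
  exact aeval_transSeries_ne_zero hinj hc hP

end Aeval

/-! ## §3 Eigenvectors of polynomially constrained linear maps -/

section Eigen

variable {Λ : Type u} [CommRing Λ] {Y : Type*} [AddCommGroup Y] [Module Λ Y]

/-- For a `Λ`-linear `S` and `y` with `S y = u • y`: `P(S) y = P(u) • y` for every `P ∈ Λ[X]`.
[cite: Greenberg2010, Lemma 5.2.2 (PDF p. 28 L20–21)] -/
theorem aeval_apply_of_apply_eq_smul (S : Y →ₗ[Λ] Y) {u : Λ} {y : Y} (hy : S y = u • y) (P : Λ[X]) :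
    aeval S P y = P.eval u • y := by
  have hpow : ∀ k : ℕ, (S ^ k) y = u ^ k • y := fun k ↦ by
    induction k with
    | zero => rw [pow_zero, pow_zero, Module.End.one_apply, one_smul]
    | succ k ih => rw [pow_succ, Module.End.mul_apply, hy, map_smul, ih, smul_smul, pow_succ, mul_comm]
  induction P using Polynomial.induction_on' with
  | add P Q hP hQ => rw [map_add, LinearMap.add_apply, hP, hQ, eval_add, add_smul]
  | monomial k a =>
    rw [aeval_monomial, eval_monomial, Module.End.mul_apply, Module.algebraMap_end_apply, hpow, smul_smul]

/-- **An "eigenvector" for an eigenvalue at which an annihilating polynomial does not vanish is zero**: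
over a domain `Λ` and a torsion-free `Λ`-module, if `P(S) = 0`, `P(u) ≠ 0` and `S y = u • y`, then
`y = 0` — the conclusion `(T*)^{σ} = 0` of the determinant form of [Greenberg2010] Lemma 5.2.2 once
`P` = a characteristic polynomial of the constant part of `σ` and `u` = its group-like part.
[cite: Greenberg2010, Lemma 5.2.2 (PDF p. 28 L20–21)] [cite: Greenberg2006, p. 342 L35–41] -/
theorem eq_zero_of_apply_eq_smul_of_aeval_eq_zero [NoZeroSMulDivisors Λ Y] (S : Y →ₗ[Λ] Y)
    {P : Λ[X]} (hPS : aeval S P = 0) {u : Λ} (hPu : P.eval u ≠ 0) {y : Y} (hy : S y = u • y) :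
    y = 0 := by
  have h := aeval_apply_of_apply_eq_smul S hy P
  rw [hPS, LinearMap.zero_apply] at h
  exact (NoZeroSMulDivisors.eq_zero_or_eq_zero_of_smul_eq_zero h.symm).resolve_left hPu

end Eigen

end Summit.BirchSwinnertonDyer.BirchSwinnertonDyer.Theorems.SignedBaseChangeAcDivGroupLikeAeval

end
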